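import Mathlib.Order.Filter.CountablyGenerated
import Literature.AnabelianGeometry.SemiGraphs.TemperedSpecialFibreTower
import Literature.AnabelianGeometry.SemiGraphs.TemperedCompactPreimage
import HarnessLib

/-!
# The quotient of a tempered group by a closed normal subgroup is tempered;
# [SemiAnbd] Example 3.10: "each of the outer semi-direct product groups `Δ[i]` … is tempered"

Mochizuki, *Semi-graphs of anabelioids*, Publ. RIMS **42** (2006), Def. 3.1 (i) p. 33 (PRIMS p. 258)
and Example 3.10, PRIMS p. 270 l. 26–29 (kurims p. 45 l. 1–4) [cite: MochizukiSemiAnbd2006, Ex 3.10 p.45]: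
"… hence also corresponding surjections of tempered groups [where we note that each of the 'outer
semi-direct product groups' [cf. §0] admits a natural topology with respect to which the resulting
topological group is tempered]: `Δ ↠ ⋯ ↠ Δ[i] := π₁^temp(𝒢_i) ⋊^out Δ_i ↠ ⋯ ↠ π₁^temp(𝒢)`".

PROOF-ONLY file (no `def`, no instance, no new `Prop`); companion of `TemperedSpecialFibreTower.lean`
(abc-iut-w5-d122, sub-DAG SemiAnbd:Ex3.10), which realises `Δ[i]` as the quotient
`SpecialFibreTower.Level i := Δ ⧸ admKer i` with its quotient topology and PROVES "each `Δ[i]` is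
temp-slim" in the slimness half (`isSlimGroup_level`).  Here the temperedness half is proved:

* `IsTempered.quotient_of_isClosed` — ENGINE: for a tempered topological group `G` (Def. 3.1 (i), the
  tree's intrinsic inverse-limit form `IsTempered`: countable-index basis, separation, completeness)
  whose topology is first countable (e.g. Galois-countable) and a CLOSED normal subgroup `K`, the
  quotient `G ⧸ K` with the quotient topology is tempered.  Basis and separation are read off `G`
  (images of open normal subgroups under the open map `G ↠ G ⧸ K`; closedness of `K`); COMPLETENESS is
  glued by successive approximation along a decreasing cofinal sequence `M₀ ⊇ M₁ ⊇ ⋯` of open normal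
  subgroups of `G`: representatives of a compatible family of cosets in `G ⧸ K` are corrected inside
  the `M_n K` to a left-Cauchy sequence in `G`, which converges by clause `complete` of `G`
  (cf. the same device in `TemperedOpenMapping.lean`, abc-iut-w5-d111);
* `SpecialFibreTower.isClosed_admKer` — the kernel `admKer i` of `Δ ↠ Δ[i]` is closed in `Δ` (it is
  the kernel of the continuous `N_i ↠ π₁^temp(𝒢_i)` into a Hausdorff (tempered) group, inside the
  clopen `N_i`);
* `SpecialFibreTower.isTempered_level` — **"`Δ[i]` … is tempered"** for the tower of Example 3.10 over
  `Δ = D.delta`, `D : TemperedArithmeticGroup K` (fields `isTempered_ker`, `secondCountableTopology`);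
  with `isSlimGroup_level`: `isTempered_and_isSlimGroup_level`, the printed "each `Δ[i]` is temp-slim"
  (p. 270 l. 40) in both of its halves.

Refereed pre-IUT material (2006); nothing here bears on [IUTchIII] Cor. 3.12; typed ≠ discharged for the
origin-parametrised statements.
-/

open Topology Filter Set

noncomputable section

namespace Literature.AnabelianGeometry.SemiGraphs

open Literature.AlgebraicGeometry.Frobenioids (IsSlimGroup)

universe u

/-! ### Engine: quotients of tempered groups by closed normal subgroups -/

section Quotient

variable {G : Type u} [Group G] [TopologicalSpace G] [IsTopologicalGroup G]
  (K : Subgroup G) [K.Normal]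

/-- The image of an open normal subgroup of `G` in `G ⧸ K` is (the underlying subgroup of) an open
normal subgroup (the quotient map is open and surjective). [folklore] -/
private theorem exists_openNormalSubgroup_eq_map_mk (M : OpenNormalSubgroup G) :
    ∃ P : OpenNormalSubgroup (G ⧸ K), P.toSubgroup = M.toSubgroup.map (QuotientGroup.mk' K) := by
  refine ⟨⟨⟨M.toSubgroup.map (QuotientGroup.mk' K), ?_⟩, ?_⟩, rfl⟩
  · change IsOpen ((M.toSubgroup.map (QuotientGroup.mk' K) : Subgroup (G ⧸ K)) : Set (G ⧸ K))
    rw [Subgroup.coe_map]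
    exact QuotientGroup.isOpenMap_coe _ M.isOpen
  · exact Subgroup.Normal.map inferInstance _ (QuotientGroup.mk'_surjective K)

/-- **The quotient of a tempered group by a closed normal subgroup is tempered** (Def. 3.1 (i)), for
`G` tempered with first-countable topology and `K ⊴ G` closed: `G ⧸ K` (quotient topology) has a basis
of open normal subgroups of countable index, these separate points (`K` closed), and compatible
families of cosets come from elements (successive approximation + completeness of `G`).
[cite: MochizukiSemiAnbd2006, Def 3.1(i) p.33] -/
theorem IsTempered.quotient_of_isClosed [FirstCountableTopology G] (hG : IsTempered G)
    (hK : IsClosed (K : Set G)) : IsTempered (G ⧸ K) := by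
  classical
  -- images `P M` of the open normal subgroups `M` of `G`
  have himg := fun M : OpenNormalSubgroup G => exists_openNormalSubgroup_eq_map_mk K M
  choose P hP using himg
  have hPmem : ∀ (M : OpenNormalSubgroup G) (z : G ⧸ K),
      z ∈ P M ↔ ∃ m : G, m ∈ M ∧ (m : G ⧸ K) = z := by
    intro M z
    change z ∈ (P M).toSubgroup ↔ _
    rw [hP M, Subgroup.mem_map]
    rfl
  have hPmk : ∀ (M : OpenNormalSubgroup G) {m : G}, m ∈ M → (m : G ⧸ K) ∈ P M :=
    fun M m hm => (hPmem M _).2 ⟨m, hm, rfl⟩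
  -- continuity of the projection at `1`
  have hpre : ∀ U ∈ 𝓝 (1 : G ⧸ K), (QuotientGroup.mk ⁻¹' U : Set G) ∈ 𝓝 (1 : G) := fun U hU =>
    QuotientGroup.continuous_mk.continuousAt.preimage_mem_nhds hU
  refine ⟨?_, ?_, ?_⟩
  · -- (a) basis of open normal subgroups of countable index
    intro U hU
    obtain ⟨M, hMc, hMU⟩ := hG.basis _ (hpre U hU)
    refine ⟨P M, ?_, fun z hz => ?_⟩
    · haveI := hMc
      have hle : M.toSubgroup ≤ (P M).toSubgroup.comap (QuotientGroup.mk' K) := fun m hm => hPmk M hm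
      refine (show Function.Surjective (QuotientGroup.map M.toSubgroup (P M).toSubgroup
        (QuotientGroup.mk' K) hle) from ?_).countable
      intro y
      induction y using QuotientGroup.induction_on with
      | H z =>
        induction z using QuotientGroup.induction_on with
        | H g => exact ⟨(g : G ⧸ M.toSubgroup), rfl⟩
    · obtain ⟨m, hm, rfl⟩ := (hPmem M z).1 hz
      exact hMU hm
  · -- (b) separation: `K` is closed
    intro x hx
    obtain ⟨g, rfl⟩ := QuotientGroup.mk_surjective x
    have hg : g ∉ K := fun h => hx ((QuotientGroup.eq_one_iff g).2 h)
    have hS : IsClosed ((fun y : G => y * g) ⁻¹' (K : Set G)) := hK.preimage (continuous_id.mul continuous_const)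
    have h1 : ((fun y : G => y * g) ⁻¹' (K : Set G))ᶜ ∈ 𝓝 (1 : G) :=
      hS.isOpen_compl.mem_nhds (by simpa using hg)
    obtain ⟨M, -, hM⟩ := hG.basis _ h1
    refine ⟨P M, fun hmem => ?_⟩
    obtain ⟨m, hm, hmg⟩ := (hPmem M _).1 hmem
    have hmK : m⁻¹ * g ∈ K := QuotientGroup.eq.1 hmg
    exact hM (M.toSubgroup.inv_mem hm) hmK
  · -- (c) completeness
    intro x hx
    -- an antitone cofinal sequence of open normal subgroups of `G`
    obtain ⟨N, -, hNb⟩ := hG.hasBasis_nhds_one.exists_antitone_subbasis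
    have hanti : ∀ ⦃m n : ℕ⦄, m ≤ n → (N n : Set G) ⊆ N m := fun m n hmn => hNb.antitone hmn
    have hcof : ∀ U ∈ 𝓝 (1 : G), ∃ k, (N k : Set G) ⊆ U := fun U hU => hNb.mem_iff.1 hU
    -- `P` is monotone
    have hPmono : ∀ {M M' : OpenNormalSubgroup G}, (M : Set G) ⊆ M' → P M ≤ P M' := by
      intro M M' h z hz
      obtain ⟨m, hm, rfl⟩ := (hPmem M z).1 hz
      exact hPmk M' (h hm)
    -- the invariant: `a` represents `x` at level `n`
    let Q : ℕ → OpenNormalSubgroup (G ⧸ K) := fun n => P (N n)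
    have hstep : ∀ (n : ℕ) (a : G),
        x (Q n) = (((a : G ⧸ K)) : (G ⧸ K) ⧸ (Q n).toSubgroup) →
        ∃ m : G, m ∈ N n ∧
          x (Q (n + 1)) = (((a * m : G) : G ⧸ K) : (G ⧸ K) ⧸ (Q (n + 1)).toSubgroup) := by
      intro n a ha
      obtain ⟨c, hc⟩ := QuotientGroup.mk_surjective (x (Q (n + 1)))
      obtain ⟨b, rfl⟩ := QuotientGroup.mk_surjective c
      have hb : x (Q n) = (((b : G ⧸ K)) : (G ⧸ K) ⧸ (Q n).toSubgroup) :=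
        hx (Q (n + 1)) (Q n) (hPmono (hanti (Nat.le_succ n))) _ hc.symm
      rw [ha] at hb
      have hab : ((a⁻¹ * b : G) : G ⧸ K) ∈ Q n := by
        have this := QuotientGroup.eq.1 hb
        rw [← QuotientGroup.mk_inv, ← QuotientGroup.mk_mul] at this
        exact this
      obtain ⟨m, hm, hmab⟩ := (hPmem (N n) _).1 hab
      refine ⟨m, hm, ?_⟩
      rw [← hc]
      congr 1
      rw [QuotientGroup.mk_mul, hmab, ← QuotientGroup.mk_mul, mul_inv_cancel_left]
    choose! step hstepN hstepI using hstep
    -- a representative at level 0 and the corrected sequence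
    obtain ⟨c₀, hc₀⟩ := QuotientGroup.mk_surjective (x (Q 0))
    obtain ⟨g₀, rfl⟩ := QuotientGroup.mk_surjective c₀
    let g : ℕ → G := fun n => Nat.rec g₀ (fun k gk => gk * step k gk) n
    have hg0 : g 0 = g₀ := rfl
    have hSucc : ∀ n, g (n + 1) = g n * step n (g n) := fun n => rfl
    have hInv : ∀ n : ℕ,
        x (Q n) = ((QuotientGroup.mk (g n) : G ⧸ K) : (G ⧸ K) ⧸ (Q n).toSubgroup) := by
      intro n
      induction n with
      | zero => rw [hg0]; exact hc₀.symm
      | succ n ih => rw [hSucc]; exact hstepI n (g n) ih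
    have hstepN' : ∀ n, step n (g n) ∈ N n := fun n => hstepN n (g n) (hInv n)
    -- left-Cauchy
    have hcauchy : ∀ m n, m ≤ n → (g m)⁻¹ * g n ∈ N m := by
      intro m n hmn
      induction n, hmn using Nat.le_induction with
      | base => simp
      | succ n hmn ih =>
        rw [hSucc, ← mul_assoc]
        exact (N m).toSubgroup.mul_mem ih (hanti hmn (hstepN' n))
    have hcoset : ∀ (M : OpenNormalSubgroup G) (a b : ℕ), (N a : Set G) ⊆ M → (N b : Set G) ⊆ M →
        (QuotientGroup.mk (g a) : G ⧸ M.toSubgroup) = QuotientGroup.mk (g b) := by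
      intro M a b ha hb
      rcases le_total a b with hab | hba
      · rw [QuotientGroup.eq]; exact ha (hcauchy a b hab)
      · rw [eq_comm, QuotientGroup.eq]; exact hb (hcauchy b a hba)
    have hk : ∀ M : OpenNormalSubgroup G, ∃ k, (N k : Set G) ⊆ M := fun M =>
      hcof _ (M.toOpenSubgroup.mem_nhds_one)
    choose k hk using hk
    obtain ⟨gl, hgl⟩ := hG.complete (fun M => (QuotientGroup.mk (g (k M)) : G ⧸ M.toSubgroup)) (by
      intro M M' hMM' a ha
      have haM' : (QuotientGroup.mk (g (k M)) : G ⧸ M'.toSubgroup) = QuotientGroup.mk a := by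
        have := congrArg (Subgroup.quotientMapOfLE (show M.toSubgroup ≤ M'.toSubgroup from hMM')) ha
        simpa using this
      rw [← haM']
      exact hcoset M' (k M') (k M) (hk M') ((hk M).trans fun z hz => hMM' hz))
    have hlim : ∀ n, (g n)⁻¹ * gl ∈ N n := by
      intro n
      have h1 : (QuotientGroup.mk (g (k (N n))) : G ⧸ (N n).toSubgroup) = QuotientGroup.mk gl :=
        hgl (N n)
      have h2 : (QuotientGroup.mk (g (k (N n))) : G ⧸ (N n).toSubgroup) = QuotientGroup.mk (g n) :=
        hcoset (N n) _ _ (hk (N n)) subset_rfl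
      rw [h2, QuotientGroup.eq] at h1
      exact h1
    -- the limit represents `x` everywhere
    refine ⟨(gl : G ⧸ K), fun L => ?_⟩
    obtain ⟨n, hn⟩ := hcof _ (hpre _ L.toOpenSubgroup.mem_nhds_one)
    have hle : Q n ≤ L := by
      intro z hz
      obtain ⟨m, hm, rfl⟩ := (hPmem (N n) z).1 hz
      exact hn hm
    have hxL : x L = ((QuotientGroup.mk (g n) : G ⧸ K) : (G ⧸ K) ⧸ L.toSubgroup) :=
      hx (Q n) L hle (QuotientGroup.mk (g n) : G ⧸ K) (hInv n)
    rw [hxL, QuotientGroup.eq]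
    have hmem : ((((g n)⁻¹ * gl : G)) : G ⧸ K) ∈ L := hle (hPmk (N n) (hlim n))
    rw [QuotientGroup.mk_mul, QuotientGroup.mk_inv] at hmem
    exact hmem

end Quotient

/-! ### [SemiAnbd] Example 3.10: `Δ[i]` is tempered -/

namespace SpecialFibreTower

section General

variable {Δ : Type u} [Group Δ] [TopologicalSpace Δ] [IsTopologicalGroup Δ] (T : SpecialFibreTower Δ)

/-- The kernel `admKer i` of "`Δ ↠ Δ[i]`" is CLOSED in `Δ`: inside the clopen `N_i` it is the kernel of
the continuous admissible quotient `N_i ↠ π₁^temp(𝒢_i)` onto a Hausdorff (tempered) group.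
[cite: MochizukiSemiAnbd2006, Ex 3.10 p.45] -/
theorem isClosed_admKer (i : ℕ) : IsClosed (T.admKer i : Set Δ) := by
  haveI : T2Space (T.chart i).G := (T.chart i).isTempered.t2Space
  -- the kernel of `adm i` is closed in `N_i`
  have hker : IsClosed (((T.adm i).toMonoidHom.ker : Subgroup (T.N i)) : Set (T.N i)) := by
    have : (((T.adm i).toMonoidHom.ker : Subgroup (T.N i)) : Set (T.N i)) = (T.adm i) ⁻¹' {1} := by
      ext n; simp [MonoidHom.mem_ker]
    rw [this]
    exact isClosed_singleton.preimage (T.adm i).continuous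
  rw [T.ker_adm i] at hker
  -- `N_i` is closed, so the closed subset `admKer i ∩ N_i = admKer i` of it is closed in `Δ`
  have hN : IsClosed (T.N i : Set Δ) := (T.N i).isClosed_of_isOpen (T.isOpen_N i)
  have himg : (T.admKer i : Set Δ) =
      Subtype.val '' (((T.admKer i).subgroupOf (T.N i) : Subgroup (T.N i)) : Set (T.N i)) := by
    ext g
    simp only [SetLike.mem_coe, Set.mem_image, Subgroup.mem_subgroupOf, Subtype.exists,
      exists_and_right, exists_eq_right]
    exact ⟨fun hg => ⟨T.admKer_le i hg, hg⟩, fun ⟨_, hg⟩ => hg⟩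
  rw [himg]
  exact hN.isClosedEmbedding_subtypeVal.isClosedMap _ hker

end General

section Delta

variable {K : Type u} [Field K] {D : TemperedArithmeticGroup K} (T : SpecialFibreTower D.delta)

/-- **"each of the 'outer semi-direct product groups' … admits a natural topology with respect to which
the resulting topological group is tempered"** ([SemiAnbd] Ex. 3.10, PRIMS p. 270 l. 26–29): for the
special-fibre tower over `Δ = π₁^temp(X^log_K̄)` of a datum `D : TemperedArithmeticGroup K`, the level
`Δ[i] = Δ ⧸ admKer i` with its quotient topology is tempered — by `IsTempered.quotient_of_isClosed` from
the fields `isTempered_ker` ("`Δ` is also tempered"), `secondCountableTopology` (Galois-countability)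
and `isClosed_admKer`. [cite: MochizukiSemiAnbd2006, Ex 3.10 p.45] -/
theorem isTempered_level (i : ℕ) [(T.admKer i).Normal] : IsTempered (T.Level i) := by
  haveI : SecondCountableTopology D.Pi := D.secondCountableTopology
  haveI : SecondCountableTopology D.delta := TopologicalSpace.Subtype.secondCountableTopology _
  have hΔ : IsTempered D.delta := D.isTempered_ker
  exact hΔ.quotient_of_isClosed (T.admKer i) (T.isClosed_admKer i)

/-- **"Note that each `Δ[i]` is temp-slim"** ([SemiAnbd] Ex. 3.10, PRIMS p. 270 l. 40), BOTH halves: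
`Δ[i]` is tempered (`isTempered_level`) and slim (`isSlimGroup_level`, abc-iut-w5-d122).
[cite: MochizukiSemiAnbd2006, Ex 3.10 p.45] -/
theorem isTempered_and_isSlimGroup_level (i : ℕ) [(T.admKer i).Normal] :
    IsTempered (T.Level i) ∧ IsSlimGroup (T.Level i) :=
  ⟨T.isTempered_level i, T.isSlimGroup_level i⟩

end Delta

end SpecialFibreTower

end Literature.AnabelianGeometry.SemiGraphs

end
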